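import Summits.QuantumFields.BalabanUV.Beta.GAN24.TaylorTrilinearDiffSlices

/-!
# `BalabanUV.Beta.GAN24.TaylorTrilinearDiffSummed` — binder row G-an2-4 ∕ (CONV-C), S-slot, road «S3-Taylor», DIFF row R3-dW:
# generic leaf, PART 4 of 7 — THE THREE ONE-DIFFERENCE-LEG SLICES SUMMED OVER THE VERTEX LOCATION (W4 BY NAME)

G-an2-4 formalisation swarm, leaf prover 15 (unit `b2b-balaban-gan24-formalise-leaf-15`, gen 14; DIFF row R3-dW holder, INTENT
CLAIMS.log l.4908).  HONEST FRAMING (cell rule, verbatim): «discharging `BetaPertH` makes Bałaban's UV stability UNCONDITIONAL — a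
real constructive-QFT result; it is NOT the continuum limit and NOT the Clay problem.»  HONEST DEPENDENCY (verbatim): «continuum YM
on T⁴ ⇐ BetaPertH ∧ nine spine estimates (0/9 proved); BetaPertH ⇐ (D1) ∧ (D4) ∧ CAP+tail; G-an2-4 gates asym, D1 and NE2/3/4.»
NOT IN PRINT; OUR BOOKKEEPING ([folklore]): elementary real analysis ∕ finite algebra on `ℤ^{d+1}`, GENERIC `d`, GENERIC blockings,
ABSTRACT legs and table; NO object of an2's typed `U = 1` system occurs, nothing is cited, no `def … : Prop`, NOTHING is asserted
or discharged of «E3Shape»∕«E3SupRate» (OPEN, not in print), of (hS, hSall), of the K-slot, of `BetaPertH`.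
NOT BetaPertH, NOT continuum, NOT Clay.

CONTEXT (asserted nowhere below).  The RATE table of the S-slot (`GAN24/StencilSlotE3RateOfPieces.e3SupRate_of_pieces`,
row owner gan24-p1) has the DIFFERENCE row R3-dW: the Wilson piece of the normalised third jet at member `n+3` (blocking
`N′ = N·Lc`) minus the one at member `n+2` (blocking `N`), `≤ cW·θ^{n+1}`.  By `E3UnitSplit.e3W_unit_split` both are (at
`d = 3`, residual `1`) the SAME unit sandwich functional — three legs, one block average, ONE explicit factor of the blocking
on the SAME translation-invariant zero-row-sum table `wilsonA` — read at two blockings.  This chain of generic leaves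
(`TaylorTrilinearCarry` ∕ `…Pairing` ∕ `…DiffSlices` ∕ `…DiffSummed` ∕ `…Transport` ∕ `…TransportBound` ∕ `…Diff`) proves the
two-level difference bound `TaylorTrilinearDiff.trilinear_diff_bound`: TRANSPORT the level-`N` legs to the finer lattice by
`quo Lc` (piecewise constant on cells), split trilinearly — the couplings «(N1-Cauchy)» enter BY THEIR SUP ONLY thanks to ONE
ABEL SUMMATION in the vertex location — and compare the transported functional with the original one EXACTLY through the
CARRY TABLE of a cell (Hermite's identity: same row sum, same first moments ⇒ second order ⇒ `O(1/N)` by the pairing lemma).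

## What is proved ([folklore], `0 sorry`)
* `abs_tsum_slice_mid_le` (difference leg at the VERTEX LOCATION: W3 `TaylorTrilinear.abs_slice_le` verbatim with `C_H := ε`),
  **`abs_tsum_slice_left_le`** (difference leg on the `w`-SITE: `(d+1)³|B|²·C_T·ε·R·e^{3δR}·(C′_H C_K + 2C_H C′_K)·Zl(δ/2)·E` — the
  sup `ε` of the difference leg, unit gradients of the two OTHER legs), `abs_tsum_slice_right_le` (the `y`-site, by `slice_swap`);
  `E = e^{−(δ/2)(|x′−u′|₁+|z′−u′|₁)}`, block sums by leaf-04's W4 `TaylorBlockSum.abs_tsum_blockAvg_le₃` BY NAME.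
-/

noncomputable section

open Finset
open scoped BigOperators
open Literature.MathematicalPhysics.QuantumFieldTheory Balaban1983to89 Balaban1983to89.Beta
open B12Sec2to5 (l1 l1_nonneg)
open ExpKernelCalculus (Zl l1_sub_triangle l1_sub_symm)
open LatticeForm (quo)

namespace Summit.QuantumFields.BalabanUV.Beta.GAN24.TaylorTrilinearDiffSummed

open Summit.QuantumFields.BalabanUV.Beta.GAN24.TaylorTrilinearLattice
open Summit.QuantumFields.BalabanUV.Beta.GAN24.TaylorTrilinear (nonneg_of_abs_le_mul_exp abs_le_of_abs_le_mul_exp)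
open Summit.QuantumFields.BalabanUV.Beta.GAN24.TaylorTrilinearPairing
open Summit.QuantumFields.BalabanUV.Beta.GAN24.TaylorTrilinearDiffSlices

variable {d : ℕ}

/-! ## §1 The three one-difference-leg slices, summed over the vertex location (W4 BY NAME) -/

section Summed

variable (M : ℕ) [NeZero M] (G K H D : Fin (d + 1) → (Fin (d + 1) → ℤ) → ℝ)
  (T : Fin (d + 1) → (Fin (d + 1) → ℤ) → (Fin (d + 1) → ℤ) → (Fin (d + 1) → ℤ) → Fin (d + 1) → Fin (d + 1) → ℝ)
  (B : Finset (Fin (d + 1) → ℤ)) (x' z' u' : Fin (d + 1) → ℤ) {δ εD CG CG' CK CK' CH CH' CT : ℝ} {R : ℕ}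

/-- [folklore] **DIFFERENCE LEG AT THE VERTEX LOCATION** (W3 verbatim, `C_H := ε_D`): the sup of `D` and ONE unit gradient
of a table leg — `|Σ'_u slice (M^{d+1})⁻¹ M G K D T B u| ≤ (d+1)³|B|²·C_T·ε_D·R·e^{2δR}·(C′_G C_K + C_G C′_K)·Zl(δ/2)·E`. -/
theorem abs_tsum_slice_mid_le (hδ : 0 < δ)
    (hG : ∀ l w, |G l w| ≤ CG * Real.exp (-δ * l1 (quo M w - x')))
    (hG' : ∀ l w j, |G l (w + Pi.single j 1) - G l w| ≤ CG' / M * Real.exp (-δ * l1 (quo M w - x')))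
    (hD : ∀ κ v, |D κ v| ≤ εD * Real.exp (-δ * l1 (quo M v - u')))
    (hK : ∀ l y, |K l y| ≤ CK * Real.exp (-δ * l1 (quo M y - z')))
    (hK' : ∀ l y j, |K l (y + Pi.single j 1) - K l y| ≤ CK' / M * Real.exp (-δ * l1 (quo M y - z')))
    (hB : ∀ s ∈ B, LatticeForm.l1 s ≤ R) (hT0 : ∀ κ v w y l l', |T κ v w y l l'| ≤ CT)
    (hTsum : ∀ κ v l l', ∑ s ∈ B, ∑ t ∈ B, T κ v (v + s) (v + t) l l' = 0) :
    |∑' u, slice (((M : ℝ) ^ (d + 1))⁻¹) M G K D T B u| ≤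
      (((d : ℝ) + 1) ^ 3 * (B.card : ℝ) ^ 2 * CT * εD * R * Real.exp (2 * δ * R) * (CG' * CK + CG * CK') *
        Zl (d + 1) (δ / 2)) * Real.exp (-(δ / 2) * (l1 (x' - u') + l1 (z' - u'))) := by
  have hM : (0 : ℝ) < M := by exact_mod_cast Nat.pos_of_ne_zero (NeZero.ne M)
  have hBR : ∀ s ∈ B, l1 s ≤ (R : ℝ) := fun s hs => l1_le_of_natl1_le (hB s hs)
  simp_rw [slice_eq_mul_slice_one (((M : ℝ) ^ (d + 1))⁻¹)]
  have hF := fun u => TaylorTrilinear.abs_slice_le M G K D T B x' z' u' zero_le_one hM.le hδ.le hG hG' hD hK hK' hBR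
    hT0 hTsum u
  refine (TaylorBlockSum.abs_tsum_blockAvg_le₃ (N := M) hδ hF).trans (le_of_eq ?_)
  field_simp

/-- [folklore] **DIFFERENCE LEG ON THE `w`-SITE OF THE TABLE**: zero row sum + ONE Abel summation in the vertex location
(`tsum_stepD_eq`) — `D` enters by its SUP only:
`|Σ'_u slice (M^{d+1})⁻¹ M D K H T B u| ≤ (d+1)³|B|²·C_T·ε_D·R·e^{3δR}·(C′_H C_K + 2 C_H C′_K)·Zl(δ/2)·E`. -/
theorem abs_tsum_slice_left_le (hδ : 0 < δ) (hCH' : 0 ≤ CH') (hCK' : 0 ≤ CK')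
    (hD : ∀ l w, |D l w| ≤ εD * Real.exp (-δ * l1 (quo M w - x')))
    (hH : ∀ κ v, |H κ v| ≤ CH * Real.exp (-δ * l1 (quo M v - u')))
    (hH' : ∀ κ v j, |H κ (v + Pi.single j 1) - H κ v| ≤ CH' / M * Real.exp (-δ * l1 (quo M v - u')))
    (hK : ∀ l y, |K l y| ≤ CK * Real.exp (-δ * l1 (quo M y - z')))
    (hK' : ∀ l y j, |K l (y + Pi.single j 1) - K l y| ≤ CK' / M * Real.exp (-δ * l1 (quo M y - z')))
    (hB : ∀ s ∈ B, LatticeForm.l1 s ≤ R) (hT0 : ∀ κ v w y l l', |T κ v w y l l'| ≤ CT)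
    (hTsum : ∀ κ v l l', ∑ s ∈ B, ∑ t ∈ B, T κ v (v + s) (v + t) l l' = 0)
    (hTinv : ∀ κ v s t l l', T κ v (v + s) (v + t) l l' = T κ 0 s t l l') :
    |∑' u, slice (((M : ℝ) ^ (d + 1))⁻¹) M D K H T B u| ≤
      (((d : ℝ) + 1) ^ 3 * (B.card : ℝ) ^ 2 * CT * εD * R * Real.exp (3 * δ * R) * (CH' * CK + 2 * CH * CK') *
        Zl (d + 1) (δ / 2)) * Real.exp (-(δ / 2) * (l1 (x' - u') + l1 (z' - u'))) := by
  have hM : (0 : ℝ) < M := by exact_mod_cast Nat.pos_of_ne_zero (NeZero.ne M)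
  -- the two scalar cancellations `(1·M)·(R/M) = R`, done first in a small context
  have hc1 : (1 * (M : ℝ)) * ((R : ℝ) / M) = R := by field_simp
  have hc2 : (1 * (M : ℝ)) * (CK' / M) = CK' := by field_simp
  have eD : (B.card : ℝ) ^ 2 * ((d : ℝ) + 1) ^ 3 * ((1 * (M : ℝ)) * CT * εD *
      ((R / M) * Real.exp (3 * δ * R) * (CH' * CK + CH * CK'))) =
      ((d : ℝ) + 1) ^ 3 * (B.card : ℝ) ^ 2 * CT * εD * Real.exp (3 * δ * R) * (CH' * CK + CH * CK') *
        ((1 * (M : ℝ)) * ((R : ℝ) / M)) := by ring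
  have eK : (B.card : ℝ) ^ 2 * ((d : ℝ) + 1) ^ 3 *
      ((1 * (M : ℝ)) * CT * εD * CH * (R * (CK' / M) * Real.exp (3 * δ * R))) =
      ((d : ℝ) + 1) ^ 3 * (B.card : ℝ) ^ 2 * CT * εD * R * Real.exp (3 * δ * R) * CH * ((1 * (M : ℝ)) * (CK' / M)) := by
    ring
  rw [hc1] at eD
  rw [hc2] at eK
  -- pointwise bounds at `c = 1`, `ν = M`
  have hFK := fun u => abs_stepK_le M 1 M D K H T B x' z' u' zero_le_one hM.le hδ.le hD hH hK' hB hT0 u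
  have hFD := fun u => abs_stepD_shifted_le M 1 M D K H T B x' z' u' zero_le_one hM.le hδ.le hCH' hCK' hD hH hH' hK
    hK' hB hT0 u
  simp only [eK] at hFK
  simp only [eD] at hFD
  -- summability of the two `c = 1` families (three-centre domination)
  have hSK := summable_of_le_three M hδ hFK
  have hSD : Summable fun u => ∑ t ∈ B, ∑ s ∈ B, ∑ l' : Fin (d + 1), ∑ l : Fin (d + 1), ∑ κ : Fin (d + 1),
      1 * (M : ℝ) * ((D l (u + s) - D l u) * H κ u * T κ u (u + s) (u + t) l l' * K l' (u + t)) := by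
    have h : ∀ u, slice 1 M D K H T B u - (∑ t ∈ B, ∑ s ∈ B, ∑ l' : Fin (d + 1), ∑ l : Fin (d + 1),
        ∑ κ : Fin (d + 1), 1 * (M : ℝ) * (D l u * H κ u * T κ u (u + s) (u + t) l l' * (K l' (u + t) - K l' u))) =
        ∑ t ∈ B, ∑ s ∈ B, ∑ l' : Fin (d + 1), ∑ l : Fin (d + 1), ∑ κ : Fin (d + 1),
          1 * (M : ℝ) * ((D l (u + s) - D l u) * H κ u * T κ u (u + s) (u + t) l l' * K l' (u + t)) := by
      intro u; rw [slice_eq_stepD_add_stepK 1 M D K H T B hTsum u]; ring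
    have hSs : Summable fun u => slice 1 (M : ℝ) D K H T B u :=
      summable_sum fun t _ => summable_sum fun s _ =>
        TaylorTrilinear.summable_slice M D K H T x' z' u' zero_le_one hM.le hδ hD hH hK hT0 t s
    exact (hSs.sub hSK).congr h
  -- the decomposition, summed; the Abel step on the `D`-step part
  have hsplit : ∑' u, slice (((M : ℝ) ^ (d + 1))⁻¹) M D K H T B u =
      ∑' u, ((M : ℝ) ^ (d + 1))⁻¹ * (∑ t ∈ B, ∑ s ∈ B, ∑ l' : Fin (d + 1), ∑ l : Fin (d + 1), ∑ κ : Fin (d + 1),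
        1 * (M : ℝ) * (D l u * T κ 0 s t l l' * (H κ (u - s) * K l' (u - s + t) - H κ u * K l' (u + t)))) +
      ∑' u, ((M : ℝ) ^ (d + 1))⁻¹ * (∑ t ∈ B, ∑ s ∈ B, ∑ l' : Fin (d + 1), ∑ l : Fin (d + 1), ∑ κ : Fin (d + 1),
        1 * (M : ℝ) * (D l u * H κ u * T κ u (u + s) (u + t) l l' * (K l' (u + t) - K l' u))) := by
    rw [tsum_mul_left, tsum_mul_left, ← tsum_stepD_eq M 1 M D K H T B x' z' u' hδ hD hH hK hTinv, ← mul_add,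
      ← hSD.tsum_add hSK, ← tsum_mul_left]
    refine tsum_congr fun u => ?_
    rw [slice_eq_mul_slice_one, slice_eq_stepD_add_stepK 1 M D K H T B hTsum u]
  rw [hsplit]
  have h1 := TaylorBlockSum.abs_tsum_blockAvg_le₃ (N := M) hδ hFD
  have h2 := TaylorBlockSum.abs_tsum_blockAvg_le₃ (N := M) hδ hFK
  refine (abs_add_le _ _).trans ((add_le_add h1 h2).trans (le_of_eq ?_))
  ring

/-- [folklore] **DIFFERENCE LEG ON THE `y`-SITE OF THE TABLE** — the mirror image (`slice_swap`) of `abs_tsum_slice_left_le`: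
`|Σ'_u slice (M^{d+1})⁻¹ M G D H T B u| ≤ (d+1)³|B|²·C_T·ε_D·R·e^{3δR}·(C′_H C_G + 2 C_H C′_G)·Zl(δ/2)·E`. -/
theorem abs_tsum_slice_right_le (hδ : 0 < δ) (hCH' : 0 ≤ CH') (hCG' : 0 ≤ CG')
    (hG : ∀ l w, |G l w| ≤ CG * Real.exp (-δ * l1 (quo M w - x')))
    (hG' : ∀ l w j, |G l (w + Pi.single j 1) - G l w| ≤ CG' / M * Real.exp (-δ * l1 (quo M w - x')))
    (hH : ∀ κ v, |H κ v| ≤ CH * Real.exp (-δ * l1 (quo M v - u')))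
    (hH' : ∀ κ v j, |H κ (v + Pi.single j 1) - H κ v| ≤ CH' / M * Real.exp (-δ * l1 (quo M v - u')))
    (hD : ∀ l y, |D l y| ≤ εD * Real.exp (-δ * l1 (quo M y - z')))
    (hB : ∀ s ∈ B, LatticeForm.l1 s ≤ R) (hT0 : ∀ κ v w y l l', |T κ v w y l l'| ≤ CT)
    (hTsum : ∀ κ v l l', ∑ s ∈ B, ∑ t ∈ B, T κ v (v + s) (v + t) l l' = 0)
    (hTinv : ∀ κ v s t l l', T κ v (v + s) (v + t) l l' = T κ 0 s t l l') :
    |∑' u, slice (((M : ℝ) ^ (d + 1))⁻¹) M G D H T B u| ≤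
      (((d : ℝ) + 1) ^ 3 * (B.card : ℝ) ^ 2 * CT * εD * R * Real.exp (3 * δ * R) * (CH' * CG + 2 * CH * CG') *
        Zl (d + 1) (δ / 2)) * Real.exp (-(δ / 2) * (l1 (x' - u') + l1 (z' - u'))) := by
  simp_rw [slice_swap _ _ G D H T B]
  have h := abs_tsum_slice_left_le M G H D (fun κ v w y l l' => T κ v y w l' l) B z' x' u' hδ hCH' hCG' hD hH hH' hG hG'
    hB (fun κ v w y l l' => hT0 κ v y w l' l) (swap_rowsum T B hTsum) (fun κ v s t l l' => hTinv κ v t s l' l)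
  rwa [add_comm (l1 (z' - u'))] at h

end Summed

end Summit.QuantumFields.BalabanUV.Beta.GAN24.TaylorTrilinearDiffSummed

end
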